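import Literature.Analysis.FluidPDE.PassiveScalarDiagMildForced
import Literature.Analysis.FluidPDE.PassiveScalarDiagExistence
import Literature.Analysis.FluidPDE.PassiveScalarDiagForcedCongr
import HarnessLib

/-!
# Existence of strongly `L²`-continuous weak solutions of the FORCED passive scalar equation with
  constant diagonal diffusion and bounded drift on `T^d`

Analysis/FluidPDE proof file (everything proved): the forced companion of the `T2` item
`PassiveScalarDiagExistence` of the diagonal parabolic layer behind Hess-Childs–Rowan's universal
total dissipator (`a = (½,1)` on the unit torus), needed so that the scalar zeroth-law statements —
which quantify over ALL weak solutions of the FORCED problem `∂ₜθ + b·∇θ = κ∑ᵢaᵢ∂ᵢ∂ᵢθ + S` — are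
not vacuous.

**Main theorem** `Torus.exists_isWeakScalarTransportDiagForcedOn_l2Continuous`: for `κ > 0`, `aᵢ > 0`,
`θ₀ ∈ L²(T^d)`, a bounded measurable velocity `u ∈ L^∞((0,T) × T^d)` weakly divergence free at a.e.
time and a source `s ∈ L²((0,T) × T^d)`, there is a weak solution `θ` of
`∂ₜθ + u·∇θ = κ∑ᵢaᵢ∂ᵢ∂ᵢθ + s` on `T^d × [0,T)` with datum `θ₀` (`Torus.IsWeakScalarTransportDiagForcedOn`)
which is the `L²`-continuous representative on `[0,T]` (`Torus.IsL2ContinuousOn (Icc 0 T) θ`, STRONG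
continuity) with `θ 0 = θ₀`; isotropic corollary `Torus.exists_isWeakScalarTransportForcedOn_l2Continuous`.
The solution is the MILD solution of the inhomogeneous problem (Pazy 1983, Ch. 4 Cor. 2.5): the
fixed point of `PassiveScalarDiagMildPicard` for the free term
`f(t)(k) = e^{-(νₖ+λ)t}θ̂₀(k) + ∫₀ᵗe^{-(νₖ+λ)(t-τ)}e^{-λτ}ŝ(τ)(k)dτ` (`Torus.forcedFreeTerm`, damping
`λ = 2(∑ⱼaⱼ⁻¹)U²/κ + 1`), undamped by `e^{λt}` (`PassiveScalarDiagMildForced`), shown to be a weak solution by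
`PassiveScalarDiagMildForcedWeakForm` and strongly continuous by uniform tail control (datum, source
and transport tails), with the slice `t = 0` set equal to `θ₀`; degenerate cases `T ≤ 0` (constant field)
and `d = ∅` (the source integrated in time along the one point of `T^∅`).

What is NOT here: the global-in-time version (`PassiveScalarDiagForcedExistenceGlobal`), energy
(in)equality and uniqueness in the forced class (`PassiveScalarDiagEnergy*`, `PassiveScalarDiagUniqueness`).

## References

* A. Pazy, *Semigroups of Linear Operators and Applications to PDE*, Springer 1983, Ch. 4 §4.2
  (mild solutions, (2.3), Def. 2.3, Cor. 2.5), Ch. 6 §6.1 Thm. 1.2 (Picard iteration).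
* R. J. DiPerna, P.-L. Lions, Invent. Math. 98 (1989) 511–547, §II.1. L. C. Evans, *PDE* (2010), §7.1.2.
* L. Grafakos, *Classical Fourier Analysis*, 3rd ed. (2014), Prop. 3.2.6 (4), Prop. 3.2.7 (3).
-/

noncomputable section

open MeasureTheory TopologicalSpace Set Function Filter UnitAddTorus
open _root_.Topology
open scoped ENNReal NNReal InnerProductSpace ComplexConjugate

namespace Literature.Analysis.FluidPDE

namespace Torus

open Literature.Analysis.FunctionSpaces.Torus Literature.Analysis.FunctionSpaces

variable {d : Type*} [Fintype d]

/-! ## Existence for the forced equation: the `L²`-continuous representative, degenerate cases, the final statement -/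

section ForcedExistence

variable [DecidableEq d]
variable {T U E Es κ : ℝ} {a : d → ℝ} {u : ℝ → UnitAddTorus d → EuclideanSpace ℝ d}
  {θ : ℝ → UnitAddTorus d → ℝ} {θ₀ : UnitAddTorus d → ℝ} {s : ℝ → UnitAddTorus d → ℝ}

/-! ### The main case `T > 0`, positive dimension -/

variable [Nonempty d] in
/-- **Existence of a strongly `L²`-continuous weak solution of the FORCED equation, `T > 0`,
positive dimension.** For `κ > 0`, `aᵢ > 0`, a bounded measurable drift on `(0,T) × T^d`, weakly
divergence free at a.e. time, `θ₀ ∈ L²(T^d)` and a source `s ∈ L²((0,T) × T^d)`, there is a weak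
solution of `∂ₜθ + u·∇θ = κ∑ᵢaᵢ∂ᵢ∂ᵢθ + s` on `T^d × [0,T)` with datum `θ₀`
(`Torus.IsWeakScalarTransportDiagForcedOn`) which is the `L²`-continuous representative on `[0,T]`
(`Torus.IsL2ContinuousOn`) with `θ(0) = θ₀` — the mild solution of the inhomogeneous problem
(Pazy 1983, Ch. 4 Cor. 2.5) constructed by the damped Picard iteration. [cite: Pazy1983, Ch. 4 §4.2, Cor. 2.5 (inhomogeneous problem), p. 107] -/
theorem exists_isWeakScalarTransportDiagForcedOn_of_pos (hT : 0 < T) (hκ : 0 < κ) (ha : ∀ i, 0 < a i)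
    (hθ₀ : MemLp θ₀ 2 volume) (hu : MemLp (stLift u) ∞ (volume.restrict (Ioo 0 T ×ˢ univ)))
    (hdiv : ∀ᵐ t ∂((volume : Measure ℝ).restrict (Ioo 0 T)), FunctionSpaces.Torus.IsWeaklyDivFree (u t))
    (hs : MemLp (uncurry s) 2 (((volume : Measure ℝ).restrict (Ioo 0 T)).prod volume)) :
    ∃ θ : ℝ → UnitAddTorus d → ℝ, IsWeakScalarTransportDiagForcedOn T a κ u s θ₀ θ ∧
      IsL2ContinuousOn (Icc 0 T) θ ∧ θ 0 = θ₀ := by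
  obtain ⟨U, hU⟩ := DriftBound.of_memLp_top hu
  have hs' := SourceL2.of_memLp hs
  obtain ⟨θ, E, hθ, hcont, hmild, htail⟩ := exists_forcedMildSolution (κ := κ) (a := a) hT hκ ha hU hθ₀ hs'
  have hsol : IsWeakScalarTransportDiagForcedOn T a κ u s θ₀ θ :=
    isWeakScalarTransportDiagForcedOn_of_forcedMild hT hκ.le ha hu hU hdiv hθ hθ₀ hs' hcont hmild
  have hL2 : IsL2ContinuousOn (Icc 0 T) θ := isL2ContinuousOn_of_coeff hθ hcont htail
  have h0 : θ 0 =ᵐ[volume] θ₀ := ae_eq_datum_of_forcedMild hT.le hθ hθ₀ hmild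
  -- replace the slice `t = 0` by `θ₀`
  set θ' : ℝ → UnitAddTorus d → ℝ := fun t => if t = 0 then θ₀ else θ t with hθ'
  have hθ't : ∀ {t : ℝ}, t ≠ 0 → θ' t = θ t := fun ht => by simp [hθ', ht]
  have hθ'0 : θ' 0 = θ₀ := by simp [hθ']
  have hae : ∀ t ∈ Icc 0 T, θ' t =ᵐ[volume] θ t := by
    intro t _
    by_cases ht0 : t = 0
    · subst ht0; rw [hθ'0]; exact h0.symm
    · rw [hθ't ht0]
  have hm : AEStronglyMeasurable (stLift θ') (volume.restrict (Ioo 0 T ×ˢ univ)) := by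
    refine hsol.aestronglyMeasurable.congr ?_
    filter_upwards [ae_restrict_mem (measurableSet_Ioo.prod MeasurableSet.univ)] with p hp
    simp only [stLift]
    rw [hθ't (Set.mem_prod.1 hp).1.1.ne']
  have hae' : ∀ᵐ t ∂((volume : Measure ℝ).restrict (Ioo 0 T)), θ' t =ᵐ[volume] θ t := by
    filter_upwards [ae_restrict_mem measurableSet_Ioo] with t ht
    rw [hθ't ht.1.ne']
  exact ⟨θ', hsol.congr_ae_slice hm hae', hL2.congr_ae_slice hae, hθ'0⟩

/-- **The degenerate case `d = ∅`**: `T^d` is a point, the velocity pairing and the diffusion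
vanish, and `θ(t) = θ₀ + ∫₀ᵗ s(τ) dτ` (the source integrated in time) is a weak solution of the
forced problem — the weak identity is integration by parts against the primitive,
`∫₀ᵀ ∂ₜψ (θ₀ + ∫₀ᵗ s) + ∫₀ᵀ s ψ + θ₀ ψ(0) = 0` — which is `L²`-continuous with `θ(0) = θ₀`. [cite: DiPernaLions1989, §II.1 (12)–(14)] -/
theorem exists_isWeakScalarTransportDiagForcedOn_of_isEmpty [IsEmpty d] (hT : 0 < T)
    (hu : MemLp (stLift u) ∞ (volume.restrict (Ioo 0 T ×ˢ univ)))
    (hdiv : ∀ᵐ t ∂((volume : Measure ℝ).restrict (Ioo 0 T)), FunctionSpaces.Torus.IsWeaklyDivFree (u t))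
    (hs : MemLp (uncurry s) 2 (((volume : Measure ℝ).restrict (Ioo 0 T)).prod volume)) :
    ∃ θ : ℝ → UnitAddTorus d → ℝ, IsWeakScalarTransportDiagForcedOn T a κ u s θ₀ θ ∧
      IsL2ContinuousOn (Icc 0 T) θ ∧ θ 0 = θ₀ := by
  haveI : IsFiniteMeasure ((volume : Measure ℝ).restrict (Ioo 0 T)) :=
    isFiniteMeasure_restrict.2 measure_Ioo_lt_top.ne
  have hs' := SourceL2.of_memLp hs
  -- the velocity is the zero field of the zero-dimensional space
  have hvec : ∀ v : EuclideanSpace ℝ d, v = 0 := fun v => Subsingleton.elim v 0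
  have hu0 : ∀ t x, u t x = 0 := fun t x => hvec _
  -- one point
  have x₀ : UnitAddTorus d := fun i => isEmptyElim i
  have hpt : ∀ f : UnitAddTorus d → ℝ, f = fun _ => f x₀ := fun f =>
    funext fun y => congrArg f (Subsingleton.elim y x₀)
  have hint : ∀ f : UnitAddTorus d → ℝ, ∫ x, f x = f x₀ := fun f => by
    rw [hpt f]; simp
  -- the source along the point and its primitive
  set σ : ℝ → ℝ := fun τ => s τ x₀ with hσ
  have hσi : IntegrableOn σ (Ioo 0 T) := by
    have h1 := hs'.integrable_uncurry.integral_prod_left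
    refine h1.congr (ae_of_all _ fun τ => ?_)
    exact hint (s τ)
  have hσi' : IntegrableOn σ (Icc 0 T) := (integrableOn_Icc_iff_integrableOn_Ioo).2 hσi
  set Φ : ℝ → ℝ := fun t => ∫ τ in Ioc 0 t, σ τ with hΦ
  have hΦc : ContinuousOn Φ (Icc 0 T) := intervalIntegral.continuousOn_primitive hσi'
  have hΦ0 : Φ 0 = 0 := by simp [hΦ]
  have hΦb : ∀ t ∈ Icc 0 T, |Φ t| ≤ ∫ τ in Ioo 0 T, |σ τ| := by
    intro t ht
    calc |Φ t| ≤ ∫ τ in Ioc 0 t, |σ τ| := by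
          rw [hΦ]; exact abs_integral_le_integral_abs
      _ ≤ ∫ τ in Icc 0 T, |σ τ| :=
          setIntegral_mono_set hσi'.abs (ae_of_all _ fun _ => abs_nonneg _)
            (ae_of_all _ (Ioc_subset_Icc_self.trans (Icc_subset_Icc_right ht.2)))
      _ = ∫ τ in Ioo 0 T, |σ τ| := (setIntegral_congr_set Ioo_ae_eq_Icc).symm
  -- the field
  set θ : ℝ → UnitAddTorus d → ℝ := fun t _ => θ₀ x₀ + Φ t with hθdef
  have hθ0 : θ 0 = θ₀ := by
    rw [hpt θ₀]; funext x; simp [hθdef, hΦ0]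
  -- `L²` continuity
  have hL2 : IsL2ContinuousOn (Icc 0 T) θ := by
    refine ⟨fun t _ => memLp_const _, fun t₀ ht₀ => ?_⟩
    have e : (fun t => scalarL2Sq (θ t - θ t₀)) = fun t => (Φ t - Φ t₀) ^ 2 := by
      funext t
      simp only [scalarL2Sq, hθdef, Pi.sub_apply]
      rw [hint]
      ring
    rw [e]
    have h : ContinuousWithinAt (fun t => (Φ t - Φ t₀) ^ 2) (Icc 0 T) t₀ :=
      ((hΦc t₀ ht₀).sub continuousWithinAt_const).pow 2
    simpa using h.tendsto
  refine ⟨θ, ?_, hL2, hθ0⟩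
  -- the weak class
  have hmeas : AEStronglyMeasurable (stLift θ) (volume.restrict (Ioo 0 T ×ˢ univ)) := by
    refine aestronglyMeasurable_stLift_of_uncurry (S := Ioo 0 T) ?_
    have e : uncurry θ = fun p : ℝ × UnitAddTorus d => θ₀ x₀ + Φ p.1 := by
      funext ⟨t, y⟩; rfl
    rw [e]
    exact ((hΦc.mono Ioo_subset_Icc_self).aestronglyMeasurable measurableSet_Ioo).const_add _ |>.comp_fst
  refine ⟨hmeas, hu.1, hs'.aestronglyMeasurable_stLift,
    ⟨((|θ₀ x₀| + ∫ τ in Ioo 0 T, |σ τ|) ^ 2).toNNReal, ?_⟩, ?_, ?_,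
    hs'.lintegral_lintegral_enorm_lt_top, hdiv, fun ψ hψ => ?_⟩
  · -- `L^∞_t L²_x` bound
    filter_upwards [ae_restrict_mem measurableSet_Ioo] with t ht
    have hb : |θ t x₀| ≤ |θ₀ x₀| + ∫ τ in Ioo 0 T, |σ τ| := by
      simp only [hθdef]
      exact (abs_add_le _ _).trans (add_le_add le_rfl (hΦb t (Ioo_subset_Icc_self ht)))
    have e : ∫⁻ x, ‖θ t x‖ₑ ^ 2 = ‖θ t x₀‖ₑ ^ 2 := by
      have : (fun x => ‖θ t x‖ₑ ^ 2) = fun _ => ‖θ t x₀‖ₑ ^ 2 := by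
        funext y; rw [Subsingleton.elim y x₀]
      rw [this, lintegral_const, measure_univ, mul_one]
    rw [e]
    change ‖θ t x₀‖ₑ ^ 2 ≤ ENNReal.ofReal ((|θ₀ x₀| + ∫ τ in Ioo 0 T, |σ τ|) ^ 2)
    rw [← ofReal_norm, ← ENNReal.ofReal_pow (norm_nonneg _), Real.norm_eq_abs]
    exact ENNReal.ofReal_le_ofReal (pow_le_pow_left₀ (abs_nonneg _) hb 2)
  · simp only [hu0, enorm_zero, ne_eq, OfNat.ofNat_ne_zero, not_false_eq_true,
      lintegral_const, zero_mul, ENNReal.zero_lt_top, zero_pow, ENNReal.zero_rpow_of_pos (by norm_num : (0:ℝ) < 1/2)]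
  · simp only [hu0, enorm_zero, zero_mul, lintegral_const, ENNReal.zero_lt_top]
  · -- the weak identity
    obtain ⟨T', hT'T, hψ0⟩ := hψ.2
    have hψT : ψ T = 0 := hψ0 T hT'T.le
    set φ : ℝ → ℝ := fun τ => ψ τ x₀ with hφ
    set φ' : ℝ → ℝ := fun τ => FunctionSpaces.Torus.timeDeriv ψ τ x₀ with hφ'
    have hder : ∀ t, HasDerivAt φ (φ' t) t := by
      intro t
      have h := ((hψ.isSmoothSpaceTimeOn univ).hasDerivWithinAt_slice (mem_univ t) x₀).hasDerivAt univ_mem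
      rwa [timeDerivWithin_eq_timeDeriv_of_contDiff hψ.1 uniqueDiffOn_univ (mem_univ t) x₀] at h
    have hcont : Continuous φ' :=
      continuous_iff_continuousAt.2 fun t =>
        (((hψ.timeDeriv.isSmoothSpaceTimeOn univ).hasDerivWithinAt_slice (mem_univ t) x₀).hasDerivAt
          univ_mem).continuousAt
    have hφT : φ T = 0 := by simp [hφ, hψT]
    -- integration by parts against the primitive (complex form of the tree, real data)
    have hIBP := setIntegral_deriv_mul_primitive_complex (χ := fun t => (φ t : ℂ)) (χ' := fun t => (φ' t : ℂ))
      (fun t => (hder t).ofReal_comp) (Complex.continuous_ofReal.comp hcont) (f := fun t => (σ t : ℂ)) hσi.ofReal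
    have hIBP' : ∫ t in Ioo 0 T, φ' t * Φ t = -∫ t in Ioo 0 T, φ t * σ t := by
      have e1 : ∀ t, (∫ τ in Ioo 0 t, ((σ τ : ℝ) : ℂ)) = ((Φ t : ℝ) : ℂ) := fun t => by
        rw [hΦ, ← integral_Ioc_eq_integral_Ioo, integral_complex_ofReal]
      simp_rw [e1] at hIBP
      rw [hφT] at hIBP
      simp only [Complex.ofReal_zero, zero_mul, zero_sub] at hIBP
      have e2 : (((∫ t in Ioo 0 T, φ' t * Φ t : ℝ) : ℂ)) = -(((∫ t in Ioo 0 T, φ t * σ t : ℝ) : ℂ)) := by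
        rw [← integral_complex_ofReal, ← integral_complex_ofReal]
        push_cast
        exact hIBP
      exact_mod_cast e2
    have hFTC : ∫ t in Ioo 0 T, φ' t = φ T - φ 0 := by
      rw [← integral_Ioc_eq_integral_Ioo, ← intervalIntegral.integral_of_le hT.le]
      exact intervalIntegral.integral_eq_sub_of_hasDerivAt (fun t _ => hder t) (hcont.intervalIntegrable _ _)
    -- rewrite the three terms of the weak identity along the point
    have hinner : ∀ t x, θ t x * (FunctionSpaces.Torus.timeDeriv ψ t x +
        ⟪u t x, FunctionSpaces.Torus.gradient (ψ t) x⟫_ℝ +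
        κ * ∑ i, a i * FunctionSpaces.Torus.partialDeriv i (FunctionSpaces.Torus.partialDeriv i (ψ t)) x) =
        θ t x * FunctionSpaces.Torus.timeDeriv ψ t x := by
      intro t x
      rw [hu0 t x, inner_zero_left, Finset.univ_eq_empty, Finset.sum_empty]
      ring
    simp_rw [hinner]
    have e1 : (∫ t in Ioo 0 T, ∫ x, θ t x * FunctionSpaces.Torus.timeDeriv ψ t x) =
        ∫ t in Ioo 0 T, (θ₀ x₀ * φ' t + φ' t * Φ t) := by
      refine setIntegral_congr_fun measurableSet_Ioo fun t _ => ?_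
      rw [hint]
      simp only [hθdef, hφ']
      ring
    have e2 : (∫ t in Ioo 0 T, ∫ x, s t x * ψ t x) = ∫ t in Ioo 0 T, φ t * σ t := by
      refine setIntegral_congr_fun measurableSet_Ioo fun t _ => ?_
      rw [hint]
      simp only [hσ, hφ]
      ring
    have hi1 : Integrable (fun t => θ₀ x₀ * φ' t) ((volume : Measure ℝ).restrict (Ioo 0 T)) :=
      (hcont.integrableOn_Icc.mono_set Ioo_subset_Icc_self).const_mul _
    have hi2 : Integrable (fun t => φ' t * Φ t) ((volume : Measure ℝ).restrict (Ioo 0 T)) :=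
      ((hcont.continuousOn.mul hΦc).integrableOn_compact isCompact_Icc).mono_set Ioo_subset_Icc_self
    rw [e1, e2, integral_add hi1 hi2, integral_const_mul, hFTC, hIBP', hint, hφT]
    simp only [hφ]
    ring

/-! ### The degenerate case `T ≤ 0`; the final statement -/

/-- For `T ≤ 0` the time interval `(0,T)` is empty and every admissible test function vanishes at
`t = 0`, so every field is a weak solution of the forced problem on `T^d × [0,T)`. [cite: DiPernaLions1989, §II.1 (12)–(14)] -/
theorem IsWeakScalarTransportDiagForcedOn.of_nonpos (hT : T ≤ 0) (θ : ℝ → UnitAddTorus d → ℝ)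
    (hu : AEStronglyMeasurable (stLift u) (volume.restrict (Ioo 0 T ×ˢ univ))) :
    IsWeakScalarTransportDiagForcedOn T a κ u s θ₀ θ := by
  have hI : Ioo (0 : ℝ) T = ∅ := Ioo_eq_empty (not_lt.2 hT)
  have hμ : (volume : Measure ℝ).restrict (Ioo 0 T) = 0 := by rw [hI, Measure.restrict_empty]
  refine ⟨?_, hu, ?_, ⟨0, ?_⟩, ?_, ?_, ?_, ?_, fun ψ hψ => ?_⟩
  · rw [hI, empty_prod, Measure.restrict_empty]
    exact aestronglyMeasurable_zero_measure _
  · rw [hI, empty_prod, Measure.restrict_empty]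
    exact aestronglyMeasurable_zero_measure _
  · rw [hμ, ae_zero]; exact eventually_bot
  · rw [hμ, lintegral_zero_measure]; exact ENNReal.zero_lt_top
  · rw [hμ, lintegral_zero_measure]; exact ENNReal.zero_lt_top
  · rw [hμ, lintegral_zero_measure]; exact ENNReal.zero_lt_top
  · rw [hμ, ae_zero]; exact eventually_bot
  · obtain ⟨T', hT', hψT'⟩ := hψ.2
    have h0 : ψ 0 = 0 := hψT' 0 (by linarith)
    rw [hμ, integral_zero_measure, integral_zero_measure, h0]
    simp

/-- **Existence of a strongly `L²`-continuous weak solution of the FORCED passive scalar equation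
with constant diagonal diffusion and bounded drift** (the forced companion of the `T2` item
`exists_isWeakScalarTransportDiagOn_l2Continuous` of the diag parabolic layer). For `κ > 0`,
coefficients `aᵢ > 0`, an `L²` datum `θ₀`, a bounded measurable velocity field
`u ∈ L^∞((0,T) × T^d)` weakly divergence free at a.e. time, and a source `s ∈ L²((0,T) × T^d)`
(`MemLp (uncurry s) 2` for the slab measure `(vol|_(0,T)) ⊗ vol`, e.g. a steady `L²` source),
there is a weak solution `θ` of `∂ₜθ + u·∇θ = κ ∑ᵢ aᵢ ∂ᵢ∂ᵢθ + s` on `T^d × [0,T)` with datum `θ₀`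
(`Torus.IsWeakScalarTransportDiagForcedOn T a κ u s θ₀ θ`, the class of the scalar zeroth-law
statements over Hess-Childs–Rowan carriers, `a = (½,1)`) which is the `L²`-CONTINUOUS representative
on `[0,T]` (`Torus.IsL2ContinuousOn (Icc 0 T) θ`) and has `θ 0 = θ₀`. Proof: the mild solution of the
inhomogeneous problem `𝓕(θ(t))(k) = e^{-νₖt}θ̂₀(k) + ∫₀ᵗe^{-νₖ(t-τ)}ŝ(τ)(k)dτ - ∫₀ᵗe^{-νₖ(t-τ)}𝓕(div(uθ))(τ)(k)dτ`
(Pazy 1983, Ch. 4 Cor. 2.5) by Picard iteration in `L^∞_t ℓ²_k` after exponential damping, shown to be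
a weak solution mode by mode and strongly continuous by uniform tail control; degenerate cases `T ≤ 0`
(constant field) and `d = ∅` (the source integrated in time). [cite: Pazy1983, Ch. 4 §4.2, Cor. 2.5 (inhomogeneous problem), p. 107] -/
theorem exists_isWeakScalarTransportDiagForcedOn_l2Continuous {T κ : ℝ} {a : d → ℝ} (hκ : 0 < κ)
    (ha : ∀ i, 0 < a i) {u : ℝ → UnitAddTorus d → EuclideanSpace ℝ d} {s : ℝ → UnitAddTorus d → ℝ}
    {θ₀ : UnitAddTorus d → ℝ} (hθ₀ : MemLp θ₀ 2 volume)
    (hu : MemLp (stLift u) ∞ (volume.restrict (Ioo 0 T ×ˢ univ)))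
    (hdiv : ∀ᵐ t ∂((volume : Measure ℝ).restrict (Ioo 0 T)), FunctionSpaces.Torus.IsWeaklyDivFree (u t))
    (hs : MemLp (uncurry s) 2 (((volume : Measure ℝ).restrict (Ioo 0 T)).prod volume)) :
    ∃ θ : ℝ → UnitAddTorus d → ℝ, IsWeakScalarTransportDiagForcedOn T a κ u s θ₀ θ ∧
      IsL2ContinuousOn (Icc 0 T) θ ∧ θ 0 = θ₀ := by
  rcases le_or_gt T 0 with hT | hT
  · exact ⟨fun _ => θ₀, IsWeakScalarTransportDiagForcedOn.of_nonpos hT _ hu.1, isL2ContinuousOn_const_time hθ₀ _, rfl⟩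
  rcases isEmpty_or_nonempty d with hd | hd
  · exact exists_isWeakScalarTransportDiagForcedOn_of_isEmpty hT hu hdiv hs
  · exact exists_isWeakScalarTransportDiagForcedOn_of_pos hT hκ ha hθ₀ hu hdiv hs

/-- **Isotropic corollary**: the same for `∂ₜθ + u·∇θ = κΔθ + s` (`Torus.IsWeakScalarTransportForcedOn`,
all coefficients `1`), with the STRONGLY `L²`-continuous representative and `θ(0) = θ₀`. [cite: Pazy1983, Ch. 4 §4.2, Cor. 2.5 (inhomogeneous problem), p. 107] -/
theorem exists_isWeakScalarTransportForcedOn_l2Continuous {T κ : ℝ} (hκ : 0 < κ)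
    {u : ℝ → UnitAddTorus d → EuclideanSpace ℝ d} {s : ℝ → UnitAddTorus d → ℝ} {θ₀ : UnitAddTorus d → ℝ}
    (hθ₀ : MemLp θ₀ 2 volume) (hu : MemLp (stLift u) ∞ (volume.restrict (Ioo 0 T ×ˢ univ)))
    (hdiv : ∀ᵐ t ∂((volume : Measure ℝ).restrict (Ioo 0 T)), FunctionSpaces.Torus.IsWeaklyDivFree (u t))
    (hs : MemLp (uncurry s) 2 (((volume : Measure ℝ).restrict (Ioo 0 T)).prod volume)) :
    ∃ θ : ℝ → UnitAddTorus d → ℝ, IsWeakScalarTransportForcedOn T κ u s θ₀ θ ∧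
      IsL2ContinuousOn (Icc 0 T) θ ∧ θ 0 = θ₀ := by
  obtain ⟨θ, hθ, hc, h0⟩ := exists_isWeakScalarTransportDiagForcedOn_l2Continuous (a := fun _ : d => (1 : ℝ)) hκ
    (fun _ => one_pos) hθ₀ hu hdiv hs
  exact ⟨θ, isWeakScalarTransportDiagForcedOn_one_iff.1 hθ, hc, h0⟩

end ForcedExistence

end Torus

end Literature.Analysis.FluidPDE

end
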